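import Literature.NumberTheory.Automorphic.IrreducibleClassesBoxChar
import Literature.NumberTheory.Automorphic.HeckeRelatedOfIntertwiner
import HarnessLib

/-!
# `π ⊠ χ` is jointly rigid: the box class determines BOTH the class and the character; a character of
# `G × G₁` is the box of its restrictions; a class whose box is one-dimensional is one-dimensional

Topic `NumberTheory/Automorphic`; namespace `Literature.NumberTheory.Automorphic.IrrClass`.  Generic smooth
representation theory, fully proved, THEOREMS only (no definition, no named fact, no `sorry`, no instance, no notation);
sequel of ★ `Automorphic/IrreducibleClassesBoxChar` (`SmoothIrrep.boxChar`, `IrrClass.boxChar χ hχ : Irr(G) → Irr(G × G₁)`,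
`⟦r⟧ ↦ ⟦r ⊠ χ⟧`, `boxChar_injective`, `boxChar_mk_ofChar`).  Cell `pub/hodgecm-mathlib`, crux H413, line LH7 (closer row
`stub_PKtupleK2`), road ED. 3 of `F0_P3c_PKtuplePaydown` (MEMO-ED3 §3 price (α), laws (L3χ)(L4)(L5)): for `H = U(Φ₂) × U(Φ₁)` over
`L⁺_v` the members of an endoscopic `H`-packet are classes `π₂,v ⊠ χ₁,v` [Rogawski1990, §12.1 p. 171; §13.3 pp. 202–203], and the glue
of the road reads a one-dimensional member `⟦ξ_v⟧ = π₂,v ⊠ χ₁,v` back as `π₂,v = ⟦ξ_v|_{U(Φ₂)}⟧`, `χ₁,v = ξ_v|_{U(Φ₁)}`.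

* §1 **(L3χ) joint injectivity** `boxChar χ hχ c = boxChar χ' hχ' c' ↔ c = c' ∧ χ = χ'` (`boxChar_eq_boxChar_iff`): an isomorphism
  `r ⊠ χ ≅ r' ⊠ χ'` restricted to `1 × G₁` compares the scalars `χ(g₁)`, `χ'(g₁)` at a nonzero vector (★ `exists_ne_zero_of_isIrreducible`,
  `Automorphic/HeckeRelatedOfIntertwiner`), so `χ = χ'` (`eq_of_boxChar_eq_boxChar`); then ★ `boxChar_injective`.
* §2 **(L2, product form)** `⟦ℂ_{χ₂}⟧ ⊠ χ₁ = ⟦ℂ_{(χ₂ ∘ fst)·(χ₁ ∘ snd)}⟧` (`boxChar_mk_ofChar_fst_mul_snd`, helper `isOpen_ker_fst_mul_snd`), and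
  **(L4) a smooth character `Ξ` of `G × G₁` is the box of its restrictions**: `⟦ℂ_Ξ⟧ = ⟦ℂ_{Ξ ∘ inl}⟧ ⊠ (Ξ ∘ inr)`
  (`mk_ofChar_eq_boxChar`, from ★ `boxChar_mk_ofChar` and `Ξ(g, g₁) = Ξ(g, 1) Ξ(1, g₁)` = `char_prod_apply_eq_comp_inl_mul_comp_inr` ∕
  `comp_inl_fst_mul_comp_inr_snd`); the restrictions have open kernels (`isOpen_ker_comp_inl`, `isOpen_ker_comp_inr`); singleton-packet
  form `boxChar_mem_singleton` (★ `LocalPacketKit.memH` is `Finset`-valued).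
* §3 **(L5) a class whose box with a character is one-dimensional is one-dimensional**: `boxChar χ hχ c = ⟦ℂ_Ξ⟧ → c = ⟦ℂ_{Ξ ∘ inl}⟧ ∧ χ = Ξ ∘ inr`
  (`eq_of_boxChar_eq_mk_ofChar`, §2 + §1), its singleton-packet form `eq_of_boxChar_mem_singleton`, and the packaged form
  `∃ χ₂ h₂, c = ⟦ℂ_{χ₂}⟧` (`exists_eq_mk_ofChar_of_boxChar_eq_mk_ofChar`).
Standard ([BushnellHenniart2006, §1.1, §1.5, §9.1]).  HONEST LABEL: HC_CM is proved only modulo the 2 remaining named inputs (hLiu418, h413)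
until rung 0 closes; this file is representation-theoretic plumbing and discharges none of them.

## References
[BushnellHenniart2006] C. J. Bushnell, G. Henniart, *The Local Langlands Conjecture for GL(2)*, Grundlehren 335 (2006), §1.1, §1.5, §9.1 ·
[Rogawski1990] J. D. Rogawski, *Automorphic Representations of Unitary Groups in Three Variables*, Ann. of Math. Stud. 123 (1990), §12.1 p. 171, §13.3 pp. 202–203.
-/

set_option autoImplicit false

noncomputable section

namespace Literature.NumberTheory.Automorphic

universe u

/-! ## §1 (L3χ) Joint injectivity of `(c, χ) ↦ c ⊠ χ` -/

namespace IrrClass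

section Joint

variable {G G₁ : Type u} [Group G] [TopologicalSpace G] [ContinuousMul G] [Group G₁] [TopologicalSpace G₁] [ContinuousMul G₁]

/-- **The box class determines the character**: if `c ⊠ χ = c' ⊠ χ'` in `Irr(G × G₁)` then `χ = χ'` — an isomorphism
`φ : r ⊠ χ ≅ r' ⊠ χ'` intertwines `(1, g₁)`, which acts by the scalars `χ(g₁)` and `χ'(g₁)`; compare at `φ v ≠ 0`.
[cite: BushnellHenniart2006, §9.1] -/
theorem eq_of_boxChar_eq_boxChar {χ χ' : G₁ →* ℂˣ} (hχ : IsOpen ((χ.ker : Subgroup G₁) : Set G₁))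
    (hχ' : IsOpen ((χ'.ker : Subgroup G₁) : Set G₁)) {c c' : IrrClass G} (h : boxChar χ hχ c = boxChar χ' hχ' c') : χ = χ' := by
  obtain ⟨r, rfl⟩ := IrrClass.mk_surjective c
  obtain ⟨r', rfl⟩ := IrrClass.mk_surjective c'
  rw [boxChar_mk, boxChar_mk, IrrClass.mk_eq_mk_iff] at h
  obtain ⟨φ⟩ := h
  obtain ⟨v, hv⟩ := exists_ne_zero_of_isIrreducible r.ρ r.isIrreducible
  refine MonoidHom.ext fun g₁ => Units.ext ?_
  -- the intertwining identity at `(1, g₁)` and the vector `v`: `χ g₁ • φ v = φ (χ g₁ • v) = χ' g₁ • φ v`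
  have key := LinearMap.congr_fun (φ.isIntertwining' ((1 : G), g₁)) v
  simp only [LinearMap.comp_apply, SmoothIrrep.boxChar_ρ_apply, map_one, Module.End.one_apply] at key
  have e : φ.toLinearMap (((χ g₁ : ℂˣ) : ℂ) • v) = ((χ g₁ : ℂˣ) : ℂ) • φ.toLinearMap v := φ.toLinearMap.map_smul _ v
  have hφv : φ.toLinearMap v ≠ 0 := fun h0 => hv (φ.toLinearEquiv.injective (h0.trans (map_zero φ.toLinearEquiv).symm))
  exact smul_left_injective ℂ hφv (e.symm.trans key)

/-- **(L3χ) `(c, χ) ↦ c ⊠ χ` is jointly injective**: `c ⊠ χ = c' ⊠ χ' ↔ c = c' ∧ χ = χ'` (the character by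
`eq_of_boxChar_eq_boxChar`, then the class by ★ `boxChar_injective`). [cite: BushnellHenniart2006, §9.1] -/
theorem boxChar_eq_boxChar_iff {c c' : IrrClass G} {χ χ' : G₁ →* ℂˣ} (hχ : IsOpen ((χ.ker : Subgroup G₁) : Set G₁))
    (hχ' : IsOpen ((χ'.ker : Subgroup G₁) : Set G₁)) :
    boxChar χ hχ c = boxChar χ' hχ' c' ↔ c = c' ∧ χ = χ' := by
  refine ⟨fun h => ?_, ?_⟩
  · obtain rfl := eq_of_boxChar_eq_boxChar hχ hχ' h
    exact ⟨boxChar_injective χ hχ h, rfl⟩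
  · rintro ⟨rfl, rfl⟩
    rfl

end Joint

/-! ## §2 (L4) A smooth character of `G × G₁` is the box of its restrictions to `G × 1` and `1 × G₁` -/

section RestrictKer

variable {G G₁ : Type u} [Group G] [TopologicalSpace G] [Group G₁] [TopologicalSpace G₁]

/-- The restriction `Ξ ∘ inl` of a smooth character `Ξ` of `G × G₁` to `G × 1` has open kernel. [cite: BushnellHenniart2006, §1.1] -/
theorem isOpen_ker_comp_inl {Ξ : G × G₁ →* ℂˣ} (hΞ : IsOpen ((Ξ.ker : Subgroup (G × G₁)) : Set (G × G₁))) :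
    IsOpen ((((Ξ.comp (MonoidHom.inl G G₁)).ker : Subgroup G)) : Set G) := by
  rw [← MonoidHom.comap_ker, Subgroup.coe_comap]
  exact hΞ.preimage (continuous_id.prodMk continuous_const : Continuous fun g : G => (g, (1 : G₁)))

/-- The restriction `Ξ ∘ inr` of a smooth character `Ξ` of `G × G₁` to `1 × G₁` has open kernel. [cite: BushnellHenniart2006, §1.1] -/
theorem isOpen_ker_comp_inr {Ξ : G × G₁ →* ℂˣ} (hΞ : IsOpen ((Ξ.ker : Subgroup (G × G₁)) : Set (G × G₁))) :
    IsOpen ((((Ξ.comp (MonoidHom.inr G G₁)).ker : Subgroup G₁)) : Set G₁) := by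
  rw [← MonoidHom.comap_ker, Subgroup.coe_comap]
  exact hΞ.preimage (continuous_const.prodMk continuous_id : Continuous fun g₁ : G₁ => ((1 : G), g₁))

omit [TopologicalSpace G] [TopologicalSpace G₁] in
/-- A character of `G × G₁` factors through its restrictions: `Ξ(g, g₁) = Ξ(g, 1) · Ξ(1, g₁)`. [cite: BushnellHenniart2006, §9.1] -/
theorem char_prod_apply_eq_comp_inl_mul_comp_inr (Ξ : G × G₁ →* ℂˣ) (g : G × G₁) :
    Ξ g = Ξ.comp (MonoidHom.inl G G₁) g.1 * Ξ.comp (MonoidHom.inr G G₁) g.2 := by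
  rw [MonoidHom.comp_apply, MonoidHom.comp_apply, ← map_mul, MonoidHom.inl_apply, MonoidHom.inr_apply, Prod.fst_mul_snd]

omit [TopologicalSpace G] [TopologicalSpace G₁] in
/-- The same identity as an equality of characters of `G × G₁`: `((Ξ ∘ inl) ∘ fst) · ((Ξ ∘ inr) ∘ snd) = Ξ`. [cite: BushnellHenniart2006, §9.1] -/
theorem comp_inl_fst_mul_comp_inr_snd (Ξ : G × G₁ →* ℂˣ) :
    (Ξ.comp (MonoidHom.inl G G₁)).comp (MonoidHom.fst G G₁) * (Ξ.comp (MonoidHom.inr G G₁)).comp (MonoidHom.snd G G₁) = Ξ :=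
  MonoidHom.ext fun g => (char_prod_apply_eq_comp_inl_mul_comp_inr Ξ g).symm

end RestrictKer

section Restrict

variable {G G₁ : Type u} [Group G] [TopologicalSpace G] [IsTopologicalGroup G] [Group G₁] [TopologicalSpace G₁] [IsTopologicalGroup G₁]

/-- The product character `(χ₂ ∘ fst) · (χ₁ ∘ snd)` of `G × G₁` has open kernel when `χ₂`, `χ₁` do (it contains the open subgroup
`ker χ₂ × ker χ₁`). [cite: BushnellHenniart2006, §1.1] -/
theorem isOpen_ker_fst_mul_snd {χ₂ : G →* ℂˣ} (h₂ : IsOpen ((χ₂.ker : Subgroup G) : Set G)) {χ₁ : G₁ →* ℂˣ}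
    (h₁ : IsOpen ((χ₁.ker : Subgroup G₁) : Set G₁)) :
    IsOpen ((((χ₂.comp (MonoidHom.fst G G₁)) * (χ₁.comp (MonoidHom.snd G G₁))).ker : Subgroup (G × G₁)) : Set (G × G₁)) := by
  refine Subgroup.isOpen_of_mem_nhds _ (g := (1 : G × G₁)) (Filter.mem_of_superset ((h₂.prod h₁).mem_nhds ?_) ?_)
  · exact Set.mk_mem_prod (χ₂.ker).one_mem (χ₁.ker).one_mem
  rintro ⟨a, b⟩ ⟨ha, hb⟩
  simp only [SetLike.mem_coe, MonoidHom.mem_ker] at ha hb ⊢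
  rw [MonoidHom.mul_apply, MonoidHom.comp_apply, MonoidHom.comp_apply, MonoidHom.coe_fst, MonoidHom.coe_snd, ha, hb, mul_one]

/-- **(L2, product form) `⟦ℂ_{χ₂}⟧ ⊠ χ₁ = ⟦ℂ_{(χ₂ ∘ fst)·(χ₁ ∘ snd)}⟧`** (★ `boxChar_mk_ofChar` at the product character).
[cite: Rogawski1990, §12.1 p. 171] [cite: BushnellHenniart2006, §9.1] -/
theorem boxChar_mk_ofChar_fst_mul_snd (χ₂ : G →* ℂˣ) (h₂ : IsOpen ((χ₂.ker : Subgroup G) : Set G)) (χ₁ : G₁ →* ℂˣ)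
    (h₁ : IsOpen ((χ₁.ker : Subgroup G₁) : Set G₁)) :
    boxChar χ₁ h₁ (IrrClass.mk (SmoothIrrep.ofChar χ₂ h₂)) =
      IrrClass.mk (SmoothIrrep.ofChar ((χ₂.comp (MonoidHom.fst G G₁)) * (χ₁.comp (MonoidHom.snd G G₁))) (isOpen_ker_fst_mul_snd h₂ h₁)) :=
  boxChar_mk_ofChar χ₂ h₂ χ₁ h₁ _ (isOpen_ker_fst_mul_snd h₂ h₁) fun _ => rfl

/-- **(L4) `⟦ℂ_Ξ⟧ = ⟦ℂ_{Ξ ∘ inl}⟧ ⊠ (Ξ ∘ inr)`** — a one-dimensional class of `G × G₁` is the box of its restriction to `G × 1`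
with its restriction to `1 × G₁` (★ `boxChar_mk_ofChar` with `Ξ(g, g₁) = Ξ(g, 1) Ξ(1, g₁)`).  For `H = U(Φ₂) × U(Φ₁)`: the character
packet member `⟦ξ_v⟧` is `⟦ξ_v|_{U(Φ₂)}⟧ ⊠ ξ_v|_{U(Φ₁)}`. [cite: Rogawski1990, §12.1 p. 171] [cite: BushnellHenniart2006, §9.1] -/
theorem mk_ofChar_eq_boxChar (Ξ : G × G₁ →* ℂˣ) (hΞ : IsOpen ((Ξ.ker : Subgroup (G × G₁)) : Set (G × G₁))) :
    IrrClass.mk (SmoothIrrep.ofChar Ξ hΞ) =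
      boxChar (Ξ.comp (MonoidHom.inr G G₁)) (isOpen_ker_comp_inr hΞ)
        (IrrClass.mk (SmoothIrrep.ofChar (Ξ.comp (MonoidHom.inl G G₁)) (isOpen_ker_comp_inl hΞ))) :=
  (boxChar_mk_ofChar (Ξ.comp (MonoidHom.inl G G₁)) (isOpen_ker_comp_inl hΞ) (Ξ.comp (MonoidHom.inr G G₁))
    (isOpen_ker_comp_inr hΞ) Ξ hΞ (char_prod_apply_eq_comp_inl_mul_comp_inr Ξ)).symm

/-- Membership form of (L4) for SINGLETON packets (the `H`-packet currency `{⟦ℂ_{ξ_v}⟧}` of ★ `GlobalPacketH.IsCharPacket`; ★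
`LocalPacketKit.memH` is `Finset`-valued): `⟦ℂ_{Ξ ∘ inl}⟧ ⊠ (Ξ ∘ inr) ∈ {⟦ℂ_Ξ⟧}`. [cite: Rogawski1990, §12.1 p. 171] -/
theorem boxChar_mem_singleton (Ξ : G × G₁ →* ℂˣ) (hΞ : IsOpen ((Ξ.ker : Subgroup (G × G₁)) : Set (G × G₁))) :
    boxChar (Ξ.comp (MonoidHom.inr G G₁)) (isOpen_ker_comp_inr hΞ)
        (IrrClass.mk (SmoothIrrep.ofChar (Ξ.comp (MonoidHom.inl G G₁)) (isOpen_ker_comp_inl hΞ))) ∈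
      ({IrrClass.mk (SmoothIrrep.ofChar Ξ hΞ)} : Finset (IrrClass (G × G₁))) :=
  Finset.mem_singleton.2 (mk_ofChar_eq_boxChar Ξ hΞ).symm

/-! ## §3 (L5) A class whose box with a character is one-dimensional is one-dimensional -/

/-- **(L5, sharp form) if `c ⊠ χ = ⟦ℂ_Ξ⟧` then `c = ⟦ℂ_{Ξ ∘ inl}⟧` and `χ = Ξ ∘ inr`** (§2 rewrites `⟦ℂ_Ξ⟧` as a box; §1 joint
injectivity).  For `H = U(Φ₂) × U(Φ₁)`: an endoscopic member `π₂,v ⊠ χ₁,v` equal to the character class `⟦ξ_v⟧` has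
`π₂,v = ⟦ξ_v|_{U(Φ₂)}⟧` and `χ₁,v = ξ_v|_{U(Φ₁)}`. [cite: Rogawski1990, §13.3 pp. 202–203] [cite: BushnellHenniart2006, §9.1] -/
theorem eq_of_boxChar_eq_mk_ofChar {c : IrrClass G} {χ : G₁ →* ℂˣ} (hχ : IsOpen ((χ.ker : Subgroup G₁) : Set G₁))
    {Ξ : G × G₁ →* ℂˣ} (hΞ : IsOpen ((Ξ.ker : Subgroup (G × G₁)) : Set (G × G₁)))
    (h : boxChar χ hχ c = IrrClass.mk (SmoothIrrep.ofChar Ξ hΞ)) :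
    c = IrrClass.mk (SmoothIrrep.ofChar (Ξ.comp (MonoidHom.inl G G₁)) (isOpen_ker_comp_inl hΞ)) ∧ χ = Ξ.comp (MonoidHom.inr G G₁) := by
  rw [mk_ofChar_eq_boxChar Ξ hΞ, boxChar_eq_boxChar_iff] at h
  exact h

/-- Membership form of (L5) for SINGLETON packets: `c ⊠ χ ∈ {⟦ℂ_Ξ⟧} → c = ⟦ℂ_{Ξ ∘ inl}⟧ ∧ χ = Ξ ∘ inr`.
[cite: Rogawski1990, §13.3 pp. 202–203] -/
theorem eq_of_boxChar_mem_singleton {c : IrrClass G} {χ : G₁ →* ℂˣ} (hχ : IsOpen ((χ.ker : Subgroup G₁) : Set G₁))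
    {Ξ : G × G₁ →* ℂˣ} (hΞ : IsOpen ((Ξ.ker : Subgroup (G × G₁)) : Set (G × G₁)))
    (h : boxChar χ hχ c ∈ ({IrrClass.mk (SmoothIrrep.ofChar Ξ hΞ)} : Finset (IrrClass (G × G₁)))) :
    c = IrrClass.mk (SmoothIrrep.ofChar (Ξ.comp (MonoidHom.inl G G₁)) (isOpen_ker_comp_inl hΞ)) ∧ χ = Ξ.comp (MonoidHom.inr G G₁) :=
  eq_of_boxChar_eq_mk_ofChar hχ hΞ (Finset.mem_singleton.1 h)

/-- **(L5) a class whose box with a character is one-dimensional is one-dimensional**: `c ⊠ χ = ⟦ℂ_Ξ⟧ → ∃ χ₂ h₂, c = ⟦ℂ_{χ₂}⟧`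
(witness `χ₂ = Ξ ∘ inl`). [cite: Rogawski1990, §13.3 pp. 202–203] [cite: BushnellHenniart2006, §9.1] -/
theorem exists_eq_mk_ofChar_of_boxChar_eq_mk_ofChar {c : IrrClass G} {χ : G₁ →* ℂˣ} (hχ : IsOpen ((χ.ker : Subgroup G₁) : Set G₁))
    {Ξ : G × G₁ →* ℂˣ} (hΞ : IsOpen ((Ξ.ker : Subgroup (G × G₁)) : Set (G × G₁)))
    (h : boxChar χ hχ c = IrrClass.mk (SmoothIrrep.ofChar Ξ hΞ)) :
    ∃ (χ₂ : G →* ℂˣ) (h₂ : IsOpen ((χ₂.ker : Subgroup G) : Set G)), c = IrrClass.mk (SmoothIrrep.ofChar χ₂ h₂) :=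
  ⟨Ξ.comp (MonoidHom.inl G G₁), isOpen_ker_comp_inl hΞ, (eq_of_boxChar_eq_mk_ofChar hχ hΞ h).1⟩

end Restrict

end IrrClass

end Literature.NumberTheory.Automorphic

end
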